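/-
Copyright (c) 2026 the pub-hodgecm-mathlib formalisation cell (harness21).  Prover seat hodgecm-mathlib-LH4-p05 (g3), req620 Track A «(D-RAM) FOUR-FRAME» squad
(unit U3_Laws, (R-18) «K-ABS-R := NI2 ⊕ KMS»; (KMS) ROAD «MODULO κ-STAGE B», the EVALUATION LEMMAS of the DEFS leaf `…DiagonalKappaCountDefs`;
dealer LH4-plan (g11) WORD #20∕#21; plan `F0/P3c/LH4/LH4-p05/g3/PLAN-KMS-modKappaStageB.v1`).  2026-09-04.
-/
import Summits.HodgeConjecture.HodgeConjecture.Theorems.F0P3cDyRamDiagonalKappaCountDefs     -- DEFS LEAF (this seat): `signChar`, `chiVec`, `cosetKappa`, `kappaCount`; brings ★ StrataDefs ED. 3 (`polarisationCosets`), ★ TorusDefs, ★ `normSign`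
import Summits.HodgeConjecture.HodgeConjecture.Theorems.F0P3cDyRamDiagonalOrbitFibreTransport  -- ★ (O2b) PART 2 p855878 (LH4-p14): `fibre_isCoset_zero` (the type-0 fibre over a normalised lattice is ONE `S_F`-coset)
import Summits.HodgeConjecture.HodgeConjecture.Theorems.F0P3cDyRamStableSumSignClasses        -- ★ p855115 (LH4-p11): `normSign_eq_one_or`; brings ★ p855032 `…FixedCountDiagonalModel.normSign_mul_norm`
import Mathlib.Tactic.FieldSimp
import HarnessLib

/-!
# Crux `H413`, line LH4 «(D-RAM) FOUR-FRAME» road — unit U3_Laws (iii), (KMS) ROAD «MODULO κ-STAGE B»: EVALUATION OF THE κ-COUNT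
# `cosetKappa σ i (D·S_F(M)) = χ_i(D)·[χ_i ≡ 1 on S_F(M)]` (under NI2) and `kappaCount = cosetKappa (D₁·S_F)` when the polarisations form one coset (all of type 0)

Cell `hodgecm-mathlib` (D-0151), FLOOR 0, crux item H413 = `stmt-HodgeConjecture-24833`, route of record `HCCMUnconditional`; squad F0∕P3c∕LH4 (req618∕req620); registered stub served:
`F0P3cDyRamFourFrameU3.stub_U3_kappaModelSum` (KMS; tree `Cruxes/H413/Lines/F0_P3c_DyRamFourFrame_U3_Laws.lean` ED. 7 :407–:429).  THEOREMS ONLY (no `def`, no instance, no notation,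
no `sorry`); lane `--supports stmt-HodgeConjecture-24833` (count-neutral).

THE MATHEMATICS.  `ω = normSign σ` is multiplicative on `σ`-fixed non-zero scalars under the index-two dichotomy with a non-norm witness `c` (§1, the statement of ★
`UnitaryThreeFourFrameFamilyExists.normSign_mul_of_dichotomy`, re-proved here in five lines to keep the diagonal-model import cone free of the CM-field files), hence so is
`χ_i(D) = Π_{j ≠ i} ω(D_j)` = `chiVec σ i D ∈ {±1}` on `σ`-fixed non-degenerate vectors; norms do not change it; on the class representatives `d_e` it is the U3 table `χ⁰_i(e)`
(`chiVec_ite_eq_signChar`), and the `ω`-pattern `e` of a vector `x` (`e j ↔ ω(x_j) = −1`) has `χ⁰_i(e) = χ_i(x)`.  §2: on an `S_F(M)`-coset `C = D·S_F(M)` the character `χ_i` is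
either CONSTANT `= χ_i(D)` (iff `χ_i ≡ 1` on `S_F(M)`) or takes BOTH signs (at `D` and `D·u₀`), so `cosetKappa σ i C = if (∀ u ∈ S_F(M), χ_i(u) = 1) then χ_i(D) else 0` — the
formula the κ-Stage-B bricks evaluate stratum by stratum (the `S_F`-congruence depths of MEMO v2 §4 against the conductor of `ω`).  §3: if the type-`tv` polarisations of `M` form ONE
`S_F(M)`-coset `D₁·S_F(M)` (the `hcoset` shape of ★ (O2b); at `tv = 0` on every normalised lattice by ★ `fibre_isCoset_zero`; FALSE on the glued type-2 strata with `ρ` even —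
LH4-p09 (g2), (R-21) — where `polarisationCount = q` and `kappaCount` is a genuine signed sum), then `polarisationCosets σ ϖ tv M = {D₁·S_F(M)}` and
`kappaCount σ ϖ tv i M = cosetKappa σ i (D₁·S_F(M))`; in particular at `tv = 0` for `M = latt g` normalised.

WHAT IS PROVED (`N = 3`, `K : Type`).
* §1 `normSign_eq_one_or`, `normSign_mul_of_dichotomy`, `normSign_mul_norm`, `chiVec_eq_one_or`, `chiVec_mul_of_dichotomy`, `chiVec_mul_norm`,
  `chiVec_ite_eq_signChar`, `signChar_eq_chiVec_of_pattern`, `signChar_xor`; §1b `normSign_ite_mul_norm` (`ω(c^{b}·zσz) = sgn b`), `normSign_apply_iff_of_mul_inv_mem_map`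
  (the class `e` of `x ∈ 𝒰` with `x·(c^{e})⁻¹ ∈ N𝒯` is its `ω`-pattern), `mul_inv_mem_map_of_normSign_iff` (converse, via ★ `existsUnique_signVector_mem_map_unitNormMap`).
* §2 `cosetKappa_coset_eq_of_dichotomy` (the evaluation), `cosetKappa_coset_eq_zero_of_exists` ∕ `cosetKappa_coset_eq_of_forall` (the two cases by name).
* §3 `polarisationCosets_eq_singleton_of_hcoset`, `kappaCount_eq_cosetKappa_of_hcoset`, `kappaCount_zero_eq_cosetKappa` (type 0, normalised `latt g`),
  `kappaCount_zero_eq_of_dichotomy` (type 0 closed form `χ_i(D₁)·[χ_i|S_F ≡ 1]`).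
HONEST LABEL.  Count-neutral (`--supports`); nothing printed is asserted; (KMS) stays a PROVER TARGET (empirical census law in diagonal-model currency); `HC_CM` is proved only modulo
the 7 printed citations (2 remaining named inputs: hLiu418 = `stmt-HodgeConjecture-24832`, h413 = `stmt-HodgeConjecture-24833`) until rung 0 closes.

## References
* [Kottwitz1986BaseChangeUnits] R. E. Kottwitz, *Base change for unit elements of Hecke algebras*, Compositio Math. 60 (1986), §1 pp. 240–241.
* [Rogawski1990] J. D. Rogawski, *Automorphic Representations of Unitary Groups in Three Variables*, Ann. of Math. Stud. 123 (1990), §4.9 Prop. 4.9.1 (a) p. 55, §4.10 p. 58.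
* [LanglandsShelstad1987] R. P. Langlands, D. Shelstad, *On the definition of transfer factors*, Math. Ann. 278 (1987), §3.
* [Serre1979] J.-P. Serre, *Local Fields*, GTM 67 (1979), Ch. V §3, Ch. XIV §3 (norm classes; the local norm index).
-/

set_option autoImplicit false

noncomputable section

namespace Summit.HodgeConjecture.HodgeConjecture.Cruxes.H413.F0P3cDyRamDiagonalKappaCountEval

open Matrix
open Literature.NumberTheory.Automorphic Literature.NumberTheory.Automorphic.HermitianLattice
open Literature.NumberTheory.Automorphic.UnitaryLatticeTree Literature.NumberTheory.Automorphic.UnitaryThreeFourFrame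
open Summit.HodgeConjecture.HodgeConjecture.Cruxes.H413.F0P3cDyRamDiagonalTorusDefs
open Summit.HodgeConjecture.HodgeConjecture.Cruxes.H413.F0P3cDyRamDiagonalStrataDefs
open Summit.HodgeConjecture.HodgeConjecture.Cruxes.H413.F0P3cDyRamDiagonalKappaCountDefs
open Summit.HodgeConjecture.HodgeConjecture.Cruxes.H413.F0P3cDyRamDiagonalOrbitFibreTransport
open Summit.HodgeConjecture.HodgeConjecture.Cruxes.H413.F0P3cDyRamStableSumSignClasses (normSign_eq_one_or)
open Summit.HodgeConjecture.HodgeConjecture.Cruxes.H413.F0P3cDyRamFixedCountDiagonalModel (normSign_mul_norm)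
open scoped Valued WithZero Matrix MatrixGroups

variable {K : Type} [Field K]

/-! ## §1  `ω` and `χ_i` algebra under the index-two dichotomy -/

/-- **`ω` IS MULTIPLICATIVE ON `σ`-FIXED NON-ZERO SCALARS** under the index-two dichotomy with a NON-NORM `σ`-fixed witness `c` (the statement of ★
`UnitaryThreeFourFrameFamilyExists.normSign_mul_of_dichotomy`; re-proved to keep the import cone light): `ω(xy) = ω(x)ω(y)`. [cite: Serre1979, Ch. XIV §3] [cite: Rogawski1990, §4.10 p. 58] -/
theorem normSign_mul_of_dichotomy (σ : K →+* K) {c : K} (hσc : σ c = c) (hc : ¬ ∃ z : K, z * σ z = c)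
    (hdich : ∀ s : K, σ s = s → s ≠ 0 → (∃ z : K, z * σ z = s) ∨ ∃ z : K, z * σ z = c * s)
    {x y : K} (hx : σ x = x) (hy : σ y = y) (hx0 : x ≠ 0) (hy0 : y ≠ 0) :
    normSign σ (x * y) = normSign σ x * normSign σ y := by
  have hc0 : c ≠ 0 := fun h => hc ⟨0, by rw [h, zero_mul]⟩
  -- `ω(N(z)) = 1`, `ω(c·N(z)) = −1`
  have hN : ∀ z : K, z ≠ 0 → normSign σ (z * σ z) = 1 := fun z _ => by
    unfold normSign; rw [if_pos ⟨z, rfl⟩]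
  have hcN : ∀ z : K, z ≠ 0 → normSign σ (c * (z * σ z)) = -1 := fun z hz => by
    rw [normSign_mul_norm σ c hz]; unfold normSign; rw [if_neg hc]
  -- write `x = c^{a}·N(z₁)`, `y = c^{b}·N(z₂)`
  have hcls : ∀ {s : K}, σ s = s → s ≠ 0 → ∃ z : K, z ≠ 0 ∧ (s = z * σ z ∨ s = c * (z * σ z)) := by
    intro s hs hs0
    rcases hdich s hs hs0 with ⟨z, hz⟩ | ⟨z, hz⟩
    · exact ⟨z, fun h0 => hs0 (by rw [← hz, h0, zero_mul]), Or.inl hz.symm⟩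
    · refine ⟨z / c, div_ne_zero (fun h0 => mul_ne_zero hc0 hs0 (by rw [← hz, h0, zero_mul])) hc0, Or.inr ?_⟩
      rw [map_div₀, hσc]
      field_simp
      linear_combination (-1 : K) * hz
  obtain ⟨z₁, hz₁, hx₁ | hx₁⟩ := hcls hx hx0 <;> obtain ⟨z₂, hz₂, hy₂ | hy₂⟩ := hcls hy hy0 <;> rw [hx₁, hy₂]
  · rw [hN z₁ hz₁, hN z₂ hz₂, show z₁ * σ z₁ * (z₂ * σ z₂) = (z₁ * z₂) * σ (z₁ * z₂) by rw [map_mul]; ring, hN _ (mul_ne_zero hz₁ hz₂)]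
    norm_num
  · rw [hN z₁ hz₁, hcN z₂ hz₂, show z₁ * σ z₁ * (c * (z₂ * σ z₂)) = c * ((z₁ * z₂) * σ (z₁ * z₂)) by rw [map_mul]; ring, hcN _ (mul_ne_zero hz₁ hz₂)]
    norm_num
  · rw [hcN z₁ hz₁, hN z₂ hz₂, show c * (z₁ * σ z₁) * (z₂ * σ z₂) = c * ((z₁ * z₂) * σ (z₁ * z₂)) by rw [map_mul]; ring, hcN _ (mul_ne_zero hz₁ hz₂)]
    norm_num
  · rw [hcN z₁ hz₁, hcN z₂ hz₂, show c * (z₁ * σ z₁) * (c * (z₂ * σ z₂)) = (c * z₁ * z₂) * σ (c * z₁ * z₂) by rw [map_mul, map_mul, hσc]; ring,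
      hN _ (mul_ne_zero (mul_ne_zero hc0 hz₁) hz₂)]
    norm_num

/-- `χ_i(D) ∈ {1, −1}`. [cite: LanglandsShelstad1987, §3] -/
theorem chiVec_eq_one_or (σ : K →+* K) (i : Fin 3) (D : Fin 3 → K) : chiVec σ i D = 1 ∨ chiVec σ i D = -1 := by
  have hmul : ∀ a b : ℤ, (a = 1 ∨ a = -1) → (b = 1 ∨ b = -1) → (a * b = 1 ∨ a * b = -1) := by
    rintro a b (rfl | rfl) (rfl | rfl) <;> norm_num
  fin_cases i
  · exact hmul _ _ (normSign_eq_one_or σ (D 1)) (normSign_eq_one_or σ (D 2))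
  · exact hmul _ _ (normSign_eq_one_or σ (D 0)) (normSign_eq_one_or σ (D 2))
  · exact hmul _ _ (normSign_eq_one_or σ (D 0)) (normSign_eq_one_or σ (D 1))

/-- **`χ_i` IS MULTIPLICATIVE ON `σ`-FIXED NON-DEGENERATE VECTORS** (under NI2): `χ_i(x·y) = χ_i(x)·χ_i(y)`. [cite: LanglandsShelstad1987, §3] [cite: Serre1979, Ch. XIV §3] -/
theorem chiVec_mul_of_dichotomy (σ : K →+* K) {c : K} (hσc : σ c = c) (hc : ¬ ∃ z : K, z * σ z = c)
    (hdich : ∀ s : K, σ s = s → s ≠ 0 → (∃ z : K, z * σ z = s) ∨ ∃ z : K, z * σ z = c * s)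
    (i : Fin 3) {x y : Fin 3 → K} (hx : ∀ j, σ (x j) = x j ∧ x j ≠ 0) (hy : ∀ j, σ (y j) = y j ∧ y j ≠ 0) :
    chiVec σ i (fun j => x j * y j) = chiVec σ i x * chiVec σ i y := by
  have hm : ∀ j, normSign σ (x j * y j) = normSign σ (x j) * normSign σ (y j) := fun j =>
    normSign_mul_of_dichotomy σ hσc hc hdich (hx j).1 (hy j).1 (hx j).2 (hy j).2
  rw [chiVec_eq, chiVec_eq, chiVec_eq]
  fin_cases i <;> simp [hm] <;> ring

/-- Norm factors do not change `χ_i`: `χ_i(x_j · z_jσz_j) = χ_i(x)` (`z_j ≠ 0`). [cite: Serre1979, Ch. V §3] -/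
theorem chiVec_mul_norm (σ : K →+* K) (i : Fin 3) (x z : Fin 3 → K) (hz : ∀ j, z j ≠ 0) :
    chiVec σ i (fun j => x j * (z j * σ (z j))) = chiVec σ i x := by
  have hm : ∀ j, normSign σ (x j * (z j * σ (z j))) = normSign σ (x j) := fun j => normSign_mul_norm σ (x j) (hz j)
  rw [chiVec_eq, chiVec_eq]
  fin_cases i <;> simp [hm]

/-- **On the class representatives `χ_i` IS the U3 table**: `χ_i(d_e) = χ⁰_i(e)` (`d_e j = c` if `e j` else `1`, `c` a non-norm, `1` a norm). [cite: Rogawski1990, §4.10 p. 58] -/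
theorem chiVec_ite_eq_signChar (σ : K →+* K) {c : K} (hc : ¬ ∃ z : K, z * σ z = c) (i : Fin 3) (e : Fin 3 → Bool) :
    chiVec σ i (fun j => if e j then c else 1) = signChar i e := by
  have h1 : normSign σ (1 : K) = 1 := by unfold normSign; rw [if_pos ⟨1, by rw [map_one, mul_one]⟩]
  have hc' : normSign σ c = -1 := by unfold normSign; rw [if_neg hc]
  have hj : ∀ j, normSign σ (if e j then c else (1 : K)) = if e j then -1 else 1 := fun j => by
    by_cases h : e j <;> simp [h, h1, hc']
  rw [chiVec_eq, signChar_eq]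
  fin_cases i <;> simp [hj]

/-- **The `ω`-PATTERN determines `χ_i`**: if `e j ↔ ω(x_j) = −1` for every slot, then `χ⁰_i(e) = χ_i(x)`. [cite: Rogawski1990, §4.10 p. 58] -/
theorem signChar_eq_chiVec_of_pattern (σ : K →+* K) (i : Fin 3) {x : Fin 3 → K} {e : Fin 3 → Bool}
    (he : ∀ j, e j = true ↔ normSign σ (x j) = -1) : signChar i e = chiVec σ i x := by
  have hj : ∀ j, (if e j then (-1 : ℤ) else 1) = normSign σ (x j) := by
    intro j
    rcases normSign_eq_one_or σ (x j) with h | h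
    · have : e j = false := by
        rcases Bool.eq_false_or_eq_true (e j) with h' | h'
        · exact absurd ((he j).1 h') (by rw [h]; decide)
        · exact h'
      rw [this, h]; rfl
    · rw [(he j).2 h, h]; rfl
  rw [chiVec_eq, signChar_eq]
  fin_cases i <;> simp [hj]

/-- **`χ⁰_i` is a character of `(ℤ∕2)³`**: `χ⁰_i(e ⊕ p) = χ⁰_i(e)·χ⁰_i(p)` (slotwise `xor`). [cite: LanglandsShelstad1987, §3] -/
theorem signChar_xor (i : Fin 3) (e p : Fin 3 → Bool) : signChar i (fun j => xor (e j) (p j)) = signChar i e * signChar i p := by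
  have hs : ∀ b b' : Bool, (if xor b b' then (-1 : ℤ) else 1) = (if b then -1 else 1) * (if b' then -1 else 1) := by decide
  fin_cases i
  · show (if xor (e 1) (p 1) then (-1 : ℤ) else 1) * (if xor (e 2) (p 2) then (-1 : ℤ) else 1) =
      ((if e 1 then (-1 : ℤ) else 1) * (if e 2 then (-1 : ℤ) else 1)) * ((if p 1 then (-1 : ℤ) else 1) * (if p 2 then (-1 : ℤ) else 1))
    rw [hs, hs]; ring
  · show (if xor (e 0) (p 0) then (-1 : ℤ) else 1) * (if xor (e 2) (p 2) then (-1 : ℤ) else 1) =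
      ((if e 0 then (-1 : ℤ) else 1) * (if e 2 then (-1 : ℤ) else 1)) * ((if p 0 then (-1 : ℤ) else 1) * (if p 2 then (-1 : ℤ) else 1))
    rw [hs, hs]; ring
  · show (if xor (e 0) (p 0) then (-1 : ℤ) else 1) * (if xor (e 1) (p 1) then (-1 : ℤ) else 1) =
      ((if e 0 then (-1 : ℤ) else 1) * (if e 1 then (-1 : ℤ) else 1)) * ((if p 0 then (-1 : ℤ) else 1) * (if p 1 then (-1 : ℤ) else 1))
    rw [hs, hs]; ring

/-! ## §1b  Norm-class patterns: the class `e` of a `σ`-fixed unit vector is read off by `ω` -/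

section Patterns

variable [Valued K ℤᵐ⁰]


omit [Valued K ℤᵐ⁰] in
/-- **`ω(c^{b}·zσz) = sgn b`** for a NON-NORM `c` and a non-zero product: `zσz` is a norm; `c·zσz` is not (else `c = N(z'∕z)`). [cite: Serre1979, Ch. V §3] -/
theorem normSign_ite_mul_norm (σ : K →+* K) {c : K} (hc : ¬ ∃ z : K, z * σ z = c) (b : Bool) (z : K)
    (hne : (if b then c else (1 : K)) * (z * σ z) ≠ 0) :
    normSign σ ((if b then c else 1) * (z * σ z)) = if b then -1 else 1 := by
  have hz : z ≠ 0 := fun h0 => hne (by rw [h0, zero_mul, mul_zero])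
  cases b
  · simp only [Bool.false_eq_true, ↓reduceIte, one_mul]
    unfold normSign
    rw [if_pos ⟨z, rfl⟩]
  · simp only [↓reduceIte]
    unfold normSign
    rw [if_neg]
    rintro ⟨z', hz'⟩
    apply hc
    refine ⟨z' / z, ?_⟩
    have hσz : σ z ≠ 0 := (map_ne_zero σ).2 hz
    rw [map_div₀, div_mul_div_comm, hz']
    field_simp

/-- **THE CLASS IS THE `ω`-PATTERN**: if `x ∈ (K^×)³` has `x·(c^{e})⁻¹ ∈ N(𝒯)` (`(c^{e})_j = cU` if `e j` else `1`, `cU = c` a non-norm), then `ω(x_j) = −1 ↔ e_j` for every slot.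
[cite: Serre1979, Ch. V §3] [cite: Rogawski1990, §4.10 p. 58] -/
theorem normSign_apply_iff_of_mul_inv_mem_map (σ : K →+* K) {c : K} (hc : ¬ ∃ z : K, z * σ z = c) (cU : Kˣ) (hcU : (cU : K) = c)
    {x : Fin 3 → Kˣ} {e : Fin 3 → Bool} (h : x * (fun j => if e j then cU else 1)⁻¹ ∈ (unitTorus K 3).map (unitNormMap σ 3)) (j : Fin 3) :
    e j = true ↔ normSign σ (x j : K) = -1 := by
  obtain ⟨t, -, ht⟩ := h
  have hj := congrArg (fun f : Fin 3 → Kˣ => ((f j : Kˣ) : K)) ht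
  simp only [Pi.mul_apply, Pi.inv_apply, Units.val_mul, Units.val_inv_eq_inv_val, unitNormMap_apply] at hj
  have hval : (((fun j => if e j then cU else 1) : Fin 3 → Kˣ) j : K) = if e j then c else 1 := by
    by_cases h : e j <;> simp [h, hcU]
  rw [hval] at hj
  have hne0 : (if e j then c else (1 : K)) ≠ 0 := by
    by_cases h : e j
    · simp only [h, ↓reduceIte]; rintro h0; exact hc ⟨0, by rw [h0, zero_mul]⟩
    · simp [h]
  have hx : (x j : K) = (if e j then c else 1) * ((t j : K) * σ (t j : K)) := by
    rw [hj]; field_simp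
  have hne : (if e j then c else (1 : K)) * ((t j : K) * σ (t j : K)) ≠ 0 := hx ▸ (x j).ne_zero
  rw [hx, normSign_ite_mul_norm σ hc (e j) (t j : K) hne]
  by_cases h : e j <;> simp [h]

/-- **… AND CONVERSELY**: under (NI2) with non-norm unit witness `c`, a `σ`-fixed unit vector `x ∈ 𝒰` whose `ω`-pattern is `e` has `x·(c^{e})⁻¹ ∈ N(𝒯)` (★ M: `x` has SOME class
`e'`; by the previous lemma `e' = e`). [cite: Serre1979, Ch. V §3] [cite: Rogawski1990, §4.10 p. 58] -/
theorem mul_inv_mem_map_of_normSign_iff {σ : K →+* K} (hvσ : ∀ a, Valued.v (σ a) = Valued.v a)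
    {c : K} (hσc : σ c = c) (hcv : Valued.v c = 1) (hc : ¬ ∃ z : K, z * σ z = c)
    (hdich : ∀ x : K, σ x = x → x ≠ 0 → (∃ z : K, z * σ z = x) ∨ ∃ z : K, z * σ z = c * x)
    (cU : Kˣ) (hcU : (cU : K) = c) {x : Fin 3 → Kˣ} (hx : x ∈ fixedUnitTorus σ 3) {e : Fin 3 → Bool}
    (he : ∀ j, e j = true ↔ normSign σ (x j : K) = -1) :
    x * (fun j => if e j then cU else 1)⁻¹ ∈ (unitTorus K 3).map (unitNormMap σ 3) := by
  obtain ⟨e', he', -⟩ := existsUnique_signVector_mem_map_unitNormMap hvσ hσc hcv hc hdich cU hcU x hx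
  have hee : e = e' := by
    funext j
    have h1 := he j
    have h2 := normSign_apply_iff_of_mul_inv_mem_map σ hc cU hcU he' j
    rcases Bool.eq_false_or_eq_true (e j) with h | h <;> rcases Bool.eq_false_or_eq_true (e' j) with h' | h'
    · rw [h, h']
    · exact absurd (h2.not.1 (by simp [h']) |> fun hn => hn (h1.1 h)) (by simp)
    · exact absurd (h1.not.1 (by simp [h]) |> fun hn => hn (h2.1 h')) (by simp)
    · rw [h, h']
  subst hee
  exact he'

end Patterns

/-! ## §2  The κ-sign of an `S_F(M)`-coset -/

section WithValuation

variable [Valued K ℤᵐ⁰]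

/-- `χ_i` of a `σ`-fixed unit stabiliser vector `u ∈ S_F(M)`, as a vector of `K`: the slots are `σ`-fixed and non-zero. [cite: Kottwitz1986BaseChangeUnits, §1 pp. 240–241] -/
theorem fixed_of_mem_fixedUnitStabilizer (σ : K →+* K) {M : Submodule 𝒪[K] (Fin 3 → K)} {u : Fin 3 → Kˣ} (hu : u ∈ fixedUnitStabilizer σ M) :
    ∀ j, σ ((u j : Kˣ) : K) = u j ∧ ((u j : Kˣ) : K) ≠ 0 :=
  fun j => ⟨((mem_fixedUnitStabilizer_iff σ M u).1 hu).2.2 j, (u j).ne_zero⟩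

/-- **THE κ-SIGN OF A COSET, CASE «χ_i ≢ 1 on S_F(M)»**: if some `u₀ ∈ S_F(M)` has `χ_i(u₀) ≠ 1`, the coset `D·S_F(M)` carries both signs (at `D` and `D·u₀`), so
`cosetKappa σ i (D·S_F(M)) = 0`. [cite: Kottwitz1986BaseChangeUnits, §1 pp. 240–241] [cite: LanglandsShelstad1987, §3] -/
theorem cosetKappa_coset_eq_zero_of_exists (σ : K →+* K) {c : K} (hσc : σ c = c) (hc : ¬ ∃ z : K, z * σ z = c)
    (hdich : ∀ s : K, σ s = s → s ≠ 0 → (∃ z : K, z * σ z = s) ∨ ∃ z : K, z * σ z = c * s) (i : Fin 3)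
    (M : Submodule 𝒪[K] (Fin 3 → K)) {D : Fin 3 → K} (hD : ∀ j, σ (D j) = D j ∧ D j ≠ 0)
    (hex : ∃ u₀ ∈ fixedUnitStabilizer σ M, chiVec σ i (fun j => ((u₀ j : Kˣ) : K)) ≠ 1) :
    cosetKappa σ i {D' : Fin 3 → K | ∃ u ∈ fixedUnitStabilizer σ M, ∀ j, D' j = D j * ((u j : Kˣ) : K)} = 0 := by
  obtain ⟨u₀, hu₀, hχ⟩ := hex
  have hχ' : chiVec σ i (fun j => ((u₀ j : Kˣ) : K)) = -1 := (chiVec_eq_one_or σ i _).resolve_left hχ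
  have hmemD : D ∈ {D' : Fin 3 → K | ∃ u ∈ fixedUnitStabilizer σ M, ∀ j, D' j = D j * ((u j : Kˣ) : K)} :=
    ⟨1, one_mem _, fun j => by simp⟩
  have hmemDu : (fun j => D j * ((u₀ j : Kˣ) : K)) ∈ {D' : Fin 3 → K | ∃ u ∈ fixedUnitStabilizer σ M, ∀ j, D' j = D j * ((u j : Kˣ) : K)} :=
    ⟨u₀, hu₀, fun j => rfl⟩
  have hmul : chiVec σ i (fun j => D j * ((u₀ j : Kˣ) : K)) = chiVec σ i D * (-1) := by
    rw [← hχ']; exact chiVec_mul_of_dichotomy σ hσc hc hdich i hD (fixed_of_mem_fixedUnitStabilizer σ hu₀)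
  rcases chiVec_eq_one_or σ i D with h | h
  · exact cosetKappa_of_exists_exists σ i ⟨_, hmemDu, by rw [hmul, h]; decide⟩ ⟨D, hmemD, by rw [h]; decide⟩
  · exact cosetKappa_of_exists_exists σ i ⟨D, hmemD, by rw [h]; decide⟩ ⟨_, hmemDu, by rw [hmul, h]; decide⟩

/-- **THE κ-SIGN OF A COSET, CASE «χ_i ≡ 1 on S_F(M)»**: `χ_i` is then constant `= χ_i(D)` on `D·S_F(M)`, so `cosetKappa σ i (D·S_F(M)) = χ_i(D)`.
[cite: Kottwitz1986BaseChangeUnits, §1 pp. 240–241] [cite: LanglandsShelstad1987, §3] -/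
theorem cosetKappa_coset_eq_of_forall (σ : K →+* K) {c : K} (hσc : σ c = c) (hc : ¬ ∃ z : K, z * σ z = c)
    (hdich : ∀ s : K, σ s = s → s ≠ 0 → (∃ z : K, z * σ z = s) ∨ ∃ z : K, z * σ z = c * s) (i : Fin 3)
    (M : Submodule 𝒪[K] (Fin 3 → K)) {D : Fin 3 → K} (hD : ∀ j, σ (D j) = D j ∧ D j ≠ 0)
    (hall : ∀ u ∈ fixedUnitStabilizer σ M, chiVec σ i (fun j => ((u j : Kˣ) : K)) = 1) :
    cosetKappa σ i {D' : Fin 3 → K | ∃ u ∈ fixedUnitStabilizer σ M, ∀ j, D' j = D j * ((u j : Kˣ) : K)} = chiVec σ i D := by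
  have hconst : ∀ D' ∈ {D' : Fin 3 → K | ∃ u ∈ fixedUnitStabilizer σ M, ∀ j, D' j = D j * ((u j : Kˣ) : K)}, chiVec σ i D' = chiVec σ i D := by
    rintro D' ⟨u, hu, hD'⟩
    have hfun : D' = fun j => D j * ((u j : Kˣ) : K) := funext hD'
    rw [hfun, chiVec_mul_of_dichotomy σ hσc hc hdich i hD (fixed_of_mem_fixedUnitStabilizer σ hu), hall u hu, mul_one]
  rcases chiVec_eq_one_or σ i D with h | h
  · rw [h]; exact cosetKappa_of_forall_eq_one σ i fun D' hD' => (hconst D' hD').trans h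
  · rw [h]; exact cosetKappa_of_forall_eq_neg_one σ i ⟨D, 1, one_mem _, fun j => by simp⟩ fun D' hD' => (hconst D' hD').trans h

open Classical in
/-- **EVALUATION OF THE κ-SIGN OF AN `S_F(M)`-COSET** (under NI2): `cosetKappa σ i (D·S_F(M)) = if (∀ u ∈ S_F(M), χ_i(u) = 1) then χ_i(D) else 0`.  This is the formula the
κ-Stage-B bricks evaluate on each stratum: ALIVE iff the `S_F(M)`-congruences force `Π_{j≠i} ω(u_j) = 1` (pair depth `≥` the conductor of `ω`), then the sign `χ_i(D)` of any
polarisation in the coset. [cite: Kottwitz1986BaseChangeUnits, §1 pp. 240–241] [cite: LanglandsShelstad1987, §3] -/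
theorem cosetKappa_coset_eq_of_dichotomy (σ : K →+* K) {c : K} (hσc : σ c = c) (hc : ¬ ∃ z : K, z * σ z = c)
    (hdich : ∀ s : K, σ s = s → s ≠ 0 → (∃ z : K, z * σ z = s) ∨ ∃ z : K, z * σ z = c * s) (i : Fin 3)
    (M : Submodule 𝒪[K] (Fin 3 → K)) {D : Fin 3 → K} (hD : ∀ j, σ (D j) = D j ∧ D j ≠ 0) :
    cosetKappa σ i {D' : Fin 3 → K | ∃ u ∈ fixedUnitStabilizer σ M, ∀ j, D' j = D j * ((u j : Kˣ) : K)} =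
      if (∀ u ∈ fixedUnitStabilizer σ M, chiVec σ i (fun j => ((u j : Kˣ) : K)) = 1) then chiVec σ i D else 0 := by
  split_ifs with hall
  · exact cosetKappa_coset_eq_of_forall σ hσc hc hdich i M hD hall
  · obtain ⟨u₀, hu₀⟩ := not_forall.1 hall
    obtain ⟨hu₀, hχ⟩ := Classical.not_imp.1 hu₀
    exact cosetKappa_coset_eq_zero_of_exists σ hσc hc hdich i M hD ⟨u₀, hu₀, hχ⟩

/-! ## §3  One coset: `kappaCount = cosetKappa (D₁·S_F)`; the type-0 closed form -/

/-- **ONE COSET ⟹ `polarisationCosets = {D₁·S_F(M)}`**: if `D₁` is a type-`tv` polarisation and every type-`tv` polarisation is `D₁·u`, `u ∈ S_F(M)` (the `hcoset` shape of ★ (O2b)),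
then the set of polarisation cosets is the singleton `{D₁·S_F(M)}`. [cite: Kottwitz1986BaseChangeUnits, §1 pp. 240–241] -/
theorem polarisationCosets_eq_singleton_of_hcoset (σ : K →+* K) (ϖ : K) (tv : ℕ) (M : Submodule 𝒪[K] (Fin 3 → K))
    {D₁ : Fin 3 → K} (hD₁ : ∀ j, σ (D₁ j) = D₁ j ∧ D₁ j ≠ 0) (hV₁ : IsVertexLattice σ ϖ (Matrix.diagonal D₁) tv M)
    (hcoset : ∀ D : Fin 3 → K, (∀ j, σ (D j) = D j ∧ D j ≠ 0) →
      (IsVertexLattice σ ϖ (Matrix.diagonal D) tv M ↔ ∃ u ∈ fixedUnitStabilizer σ M, ∀ j, D j = D₁ j * ((u j : Kˣ) : K))) :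
    polarisationCosets σ ϖ tv M = {{D' : Fin 3 → K | ∃ u ∈ fixedUnitStabilizer σ M, ∀ j, D' j = D₁ j * ((u j : Kˣ) : K)}} := by
  ext C
  rw [mem_polarisationCosets_iff, Set.mem_singleton_iff]
  constructor
  · rintro ⟨D, ⟨hD, hV⟩, rfl⟩
    obtain ⟨u₀, hu₀, hDu₀⟩ := (hcoset D hD).1 hV
    ext D'
    simp only [Set.mem_setOf_eq]
    constructor
    · rintro ⟨u, hu, hD'⟩
      exact ⟨u₀ * u, mul_mem hu₀ hu, fun j => by rw [hD' j, hDu₀ j, Pi.mul_apply, Units.val_mul, mul_assoc]⟩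
    · rintro ⟨u, hu, hD'⟩
      refine ⟨u₀⁻¹ * u, mul_mem (inv_mem hu₀) hu, fun j => ?_⟩
      rw [hD' j, hDu₀ j, Pi.mul_apply, Pi.inv_apply, Units.val_mul, Units.val_inv_eq_inv_val]
      field_simp
  · rintro rfl
    exact ⟨D₁, ⟨hD₁, hV₁⟩, rfl⟩

/-- **ONE COSET ⟹ `kappaCount = cosetKappa (D₁·S_F(M))`** (finsum over a singleton). [cite: Kottwitz1986BaseChangeUnits, §1 pp. 240–241] [cite: LanglandsShelstad1987, §3] -/
theorem kappaCount_eq_cosetKappa_of_hcoset (σ : K →+* K) (ϖ : K) (tv : ℕ) (i : Fin 3) (M : Submodule 𝒪[K] (Fin 3 → K))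
    {D₁ : Fin 3 → K} (hD₁ : ∀ j, σ (D₁ j) = D₁ j ∧ D₁ j ≠ 0) (hV₁ : IsVertexLattice σ ϖ (Matrix.diagonal D₁) tv M)
    (hcoset : ∀ D : Fin 3 → K, (∀ j, σ (D j) = D j ∧ D j ≠ 0) →
      (IsVertexLattice σ ϖ (Matrix.diagonal D) tv M ↔ ∃ u ∈ fixedUnitStabilizer σ M, ∀ j, D j = D₁ j * ((u j : Kˣ) : K))) :
    kappaCount σ ϖ tv i M = cosetKappa σ i {D' : Fin 3 → K | ∃ u ∈ fixedUnitStabilizer σ M, ∀ j, D' j = D₁ j * ((u j : Kˣ) : K)} := by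
  rw [kappaCount_eq, polarisationCosets_eq_singleton_of_hcoset σ ϖ tv M hD₁ hV₁ hcoset, finsum_mem_singleton]

/-- **TYPE 0, NORMALISED LATTICE: `kappaCount σ ϖ 0 i (latt g) = cosetKappa σ i (D₁·S_F)`** for any type-0 polarisation `D₁` (the one-coset property is ★ `fibre_isCoset_zero`).
[cite: Kottwitz1986BaseChangeUnits, §1 pp. 240–241] [cite: LanglandsShelstad1987, §3] -/
theorem kappaCount_zero_eq_cosetKappa {σ : K →+* K} (hvσ : ∀ a, Valued.v (σ a) = Valued.v a) (ϖ : K) (i : Fin 3) (g : GL (Fin 3) K)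
    {M : Submodule 𝒪[K] (Fin 3 → K)} (hM : M = latt (g : Matrix (Fin 3) (Fin 3) K)) (hnorm : IsNormalisedLattice M)
    {D₁ : Fin 3 → K} (hD₁ : ∀ j, σ (D₁ j) = D₁ j ∧ D₁ j ≠ 0) (hV₁ : IsVertexLattice σ ϖ (Matrix.diagonal D₁) 0 M) :
    kappaCount σ ϖ 0 i M = cosetKappa σ i {D' : Fin 3 → K | ∃ u ∈ fixedUnitStabilizer σ M, ∀ j, D' j = D₁ j * ((u j : Kˣ) : K)} :=
  kappaCount_eq_cosetKappa_of_hcoset σ ϖ 0 i M hD₁ hV₁ (fibre_isCoset_zero hvσ ϖ g hM hnorm D₁ hD₁ hV₁)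

open Classical in
/-- **TYPE 0 CLOSED FORM** (under NI2): for a normalised `M = latt g` with a type-0 polarisation `D₁`,
`kappaCount σ ϖ 0 i M = if (∀ u ∈ S_F(M), χ_i(u) = 1) then χ_i(D₁) else 0` — `D₁`-free, in `{−1, 0, 1}`. [cite: Kottwitz1986BaseChangeUnits, §1 pp. 240–241] [cite: LanglandsShelstad1987, §3] -/
theorem kappaCount_zero_eq_of_dichotomy {σ : K →+* K} (hvσ : ∀ a, Valued.v (σ a) = Valued.v a) {c : K} (hσc : σ c = c) (hc : ¬ ∃ z : K, z * σ z = c)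
    (hdich : ∀ s : K, σ s = s → s ≠ 0 → (∃ z : K, z * σ z = s) ∨ ∃ z : K, z * σ z = c * s) (ϖ : K) (i : Fin 3) (g : GL (Fin 3) K)
    {M : Submodule 𝒪[K] (Fin 3 → K)} (hM : M = latt (g : Matrix (Fin 3) (Fin 3) K)) (hnorm : IsNormalisedLattice M)
    {D₁ : Fin 3 → K} (hD₁ : ∀ j, σ (D₁ j) = D₁ j ∧ D₁ j ≠ 0) (hV₁ : IsVertexLattice σ ϖ (Matrix.diagonal D₁) 0 M) :
    kappaCount σ ϖ 0 i M = if (∀ u ∈ fixedUnitStabilizer σ M, chiVec σ i (fun j => ((u j : Kˣ) : K)) = 1) then chiVec σ i D₁ else 0 := by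
  rw [kappaCount_zero_eq_cosetKappa hvσ ϖ i g hM hnorm hD₁ hV₁, cosetKappa_coset_eq_of_dichotomy σ hσc hc hdich i M hD₁]

end WithValuation

end Summit.HodgeConjecture.HodgeConjecture.Cruxes.H413.F0P3cDyRamDiagonalKappaCountEval

end
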